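import Summits.ResolutionOfSingularities.ResolutionOfSingularities.Theorems.PurelyInseparableDim4LoopCLocalEscapeUniform
import Summits.ResolutionOfSingularities.ResolutionOfSingularities.Theorems.PurelyInseparableDim4CrossingLineLocalWin
import HarnessLib

/-!
# [OURS · res-dim4-pi · F4-C-loc] At `P₁` the maximal-dimensional-component class wins the LOCAL game over EVERY
  field of characteristic 3 (all `L`-points over the current point, not only the `𝔽₃`-rational ones)

Cell `res-dim4-pi` (D-0157 DOOR 2, wave 2), seat `res-dim4-p-6` g2; lifts `CrossingFix.localWin_P1` (p665509,
`decide` over `ZMod 3`) with the uniform tool (`UniformNoReply`, p667095) exactly as `…LoopCLocalEscapeUniform` did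
for LOOP-C.  Data: crit-1's `P₁ = x₁x₃²x₄² + x₁³x₂` and its origin-child `P1a = x₁x₄² + x₁³x₂`
(`CrossingFix.P1`/`P1a`).

* §1 certificates (‖ K over `𝔽₃`): blow-up of the plane `V(x₁,x₃)` at `P₁` — `x₁`-chart: MAXIMAL WITNESS `x₂`
  (no reply at all); `x₃`-chart: SINGLE SOURCE `x₄²` from `x₁x₄²`, coefficient `β` (the fibre coordinate) — so an
  equimultiple `L`-point is the chart origin; blow-up of `V(x₁,x₄)` at `P1a` — maximal witnesses `x₄²` / `x₁`.
* §2 over every field `L` of characteristic `3`: `no_local_reply_P1_x1_allFields`, `local_reply_P1_x3_eq_zero_allFields`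
  (`β = 0`), `no_local_reply_P1a_allFields`, `step_origin_P1_allFields` (the origin reply lands on `P1a`),
  **`localWin_P1_allFields : RWins 3 localB (liftState L P1.toState)`** — with `CrossingFix.crossing_rule_loses_at_P1`
  (the crossing line loops on the SPINE, a fortiori locally over every field) the state `P₁` separates the two
  rule classes in the local game over EVERY field of characteristic `3` (`P1_separates_rule_classes_allFields`).

Scope (honest): the LOCAL game; statements about OUR frame and two rule classes at one located state; NOTHING here is
a statement about resolution of singularities — resolution in dimension `≥ 4` / characteristic `p > 0` is NOT proved by
anything in this file.  [OURS · counted 0 · kernel certificates + symbolic coefficient law; AI kernel work, weaker than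
expert review.]  bears_on: LADDER-RESOLUTION:D157-DOOR2 (res-dim4-pi · F4-C-loc(3,3) all fields · C-P1).  Host item
(DR-157-C): `stmt-ResolutionOfSingularities-16155`, helper.
-/

set_option linter.dupNamespace false -- mandated namespace of this single-conjunct summit

noncomputable section

open MvPolynomial Finset
open scoped BigOperators

namespace Summit.ResolutionOfSingularities.ResolutionOfSingularities.Theorems.PIDim4

namespace CrossingFix

open Literature.AlgebraicGeometry.Resolution
open Literature.AlgebraicGeometry.Resolution.CentreBlowup
open StepKit LoopCLocal UniformNoReply

/-! ## §1 The certificates over `𝔽₃` -/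

/-- `P₁`, plane `V(x₁,x₃)`, `x₁`-chart: maximal witness `x₂` (the chart transform is `x₃²x₄² + x₂`).
[OURS · ‖ K] -/
theorem w_P1_x1 : uniformWitnessB 3 {0, 2} 0 (({0, 2} : Finset (Fin 4)).erase 0) P1.L ![0, 1, 0, 0] = true := by
  decide +kernel

/-- `P₁`, plane `V(x₁,x₃)`, `x₃`-chart: `x₄²` has the single source `x₁x₄²` (the chart transform is
`x₁x₄² + x₁³x₂`; its other candidate source `x₁³x₂ ↦ x₁x₂` carries the binomial `C(3,1) = 0` in characteristic 3
and is not needed). [OURS · ‖ K] -/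
theorem ss_P1_x3 :
    singleSourceB 3 {0, 2} 2 (({0, 2} : Finset (Fin 4)).erase 2) P1.L ![0, 0, 0, 2] ![1, 0, 0, 2] = true := by
  decide +kernel

/-- `P1a`, plane `V(x₁,x₄)`, `x₁`-chart: maximal witness `x₄²`. [OURS · ‖ K] -/
theorem w_P1a_x1 : uniformWitnessB 3 {0, 3} 0 (({0, 3} : Finset (Fin 4)).erase 0) P1a.L ![0, 0, 0, 2] = true := by
  decide +kernel

/-- `P1a`, plane `V(x₁,x₄)`, `x₄`-chart: maximal witness `x₁`. [OURS · ‖ K] -/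
theorem w_P1a_x4 : uniformWitnessB 3 {0, 3} 3 (({0, 3} : Finset (Fin 4)).erase 3) P1a.L ![1, 0, 0, 0] = true := by
  decide +kernel

/-! ## §2 Over every field of characteristic 3 -/

section AllFields

variable (L : Type) [Field L] [CharP L 3]

/-- `P₁`, plane `V(x₁,x₃)`, `x₁`-chart: no equimultiple `L`-point over the current point. [OURS · ‖ K] -/
theorem no_local_reply_P1_x1_allFields {b : Fin 4 → L} (hbj : b 0 = 0)
    (hb : ∀ m : Fin 4, m ∉ ({0, 2} : Finset (Fin 4)) → b m = 0) :
    ¬ IsEquimultiplePoint 3 {0, 2} 0 b (liftState L P1.toState) :=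
  not_isEquimultiplePoint_of_uniformWitnessB (φ3 L) w_P1_x1 (vanish_erase L hbj hb)

/-- `P₁`, plane `V(x₁,x₃)`, `x₃`-chart: an equimultiple `L`-point over the current point is the chart origin (the
`x₄²`-coefficient of the point transform is the fibre coordinate `β = b₀`). [OURS · ‖ K] -/
theorem local_reply_P1_x3_eq_zero_allFields {b : Fin 4 → L} (hbj : b 2 = 0)
    (hb : ∀ m : Fin 4, m ∉ ({0, 2} : Finset (Fin 4)) → b m = 0)
    (heq : IsEquimultiplePoint 3 {0, 2} 2 b (liftState L P1.toState)) : b = 0 := by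
  have hprod := prod_eq_zero_of_isEquimultiplePoint_of_singleSourceB (φ3 L) ss_P1_x3 (vanish_erase L hbj hb) heq
  have h0 : b 0 = 0 := by
    simp [Fin.prod_univ_four] at hprod
    exact hprod
  funext i
  fin_cases i
  · exact h0
  · exact hb 1 (by decide)
  · exact hbj
  · exact hb 3 (by decide)

/-- `P1a`, plane `V(x₁,x₄)`: no equimultiple `L`-point over the current point in either chart. [OURS · ‖ K] -/
theorem no_local_reply_P1a_allFields {j : Fin 4} (hj : j ∈ ({0, 3} : Finset (Fin 4))) {b : Fin 4 → L}
    (hbj : b j = 0) (hb : ∀ m : Fin 4, m ∉ ({0, 3} : Finset (Fin 4)) → b m = 0) :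
    ¬ IsEquimultiplePoint 3 {0, 3} j b (liftState L P1a.toState) := by
  rcases mem_pair hj with rfl | rfl
  · exact not_isEquimultiplePoint_of_uniformWitnessB (φ3 L) w_P1a_x1 (vanish_erase L hbj hb)
  · exact not_isEquimultiplePoint_of_uniformWitnessB (φ3 L) w_P1a_x4 (vanish_erase L hbj hb)

/-- The origin reply at `P₁` (plane `V(x₁,x₃)`, `x₃`-chart) lands on `P1a`, over `L`. [OURS · ‖ K] -/
theorem step_origin_P1_allFields [DecidableEq L] :
    CentreBlowup.step 3 {0, 2} 2 (0 : Fin 4 → L) (liftState L P1.toState) = liftState L P1a.toState := by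
  have h := (step_eq_iff 3 {0, 2} 2 (0 : Fin 4 → ZMod 3) P1 P1a).mpr (by decide +kernel)
  rw [liftState, step_baseChange_zero (φ3 L) 3 {0, 2} 2 P1.toState, h]
  rfl

/-- **`P1a` is a local A-win over every field of characteristic 3** (play `V(x₁,x₄)`: no reply). [OURS · ‖ K] -/
theorem localWin_P1a_allFields [DecidableEq L] : RWins 3 localB (liftState L P1a.toState) :=
  Game.Wins.move (m := ({0, 3} : Finset (Fin 4)))
    (legal_lift L inScope_P1a (by decide +kernel))
    fun _ ⟨_, b, hj, hbj, hloc, heq, _, _⟩ =>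
      absurd heq (no_local_reply_P1a_allFields L hj hbj ((localB_eq_true_iff _ _ b).mp hloc))

/-- **`P₁` is a local A-win over EVERY field of characteristic 3, in two moves**: play the plane `V(x₁,x₃)`; the only
equimultiple `L`-point over the current point is the `x₃`-chart origin, landing on `P1a`; there play `V(x₁,x₄)`.
[OURS · ‖ K] -/
theorem localWin_P1_allFields [DecidableEq L] : RWins 3 localB (liftState L P1.toState) := by
  refine Game.Wins.move (m := ({0, 2} : Finset (Fin 4))) (legal_lift L inScope_P1 (by decide +kernel)) ?_
  rintro s' ⟨j, b, hj, hbj, hloc, heq, -, rfl⟩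
  have hb := (localB_eq_true_iff _ j b).mp hloc
  rcases mem_pair hj with rfl | rfl
  · exact absurd heq (no_local_reply_P1_x1_allFields L hbj hb)
  · obtain rfl := local_reply_P1_x3_eq_zero_allFields L hbj hb heq
    rw [step_origin_P1_allFields]
    exact localWin_P1a_allFields L

/-- **`P₁` separates the rule classes in the LOCAL game over EVERY field of characteristic 3**: crossing-line rules
loop at `P₁` on the spine (`crossing_rule_loses_at_P1`, base-changed by `ScopeBaseChange.spineEdge_map`), while A
wins locally from the lifted `P₁` by playing planes. [OURS · ‖ K] -/
theorem P1_separates_rule_classes_allFields [DecidableEq L] :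
    SpineEdge 3 U1 (liftState L P1.toState) (liftState L P1.toState) ∧ RWins 3 localB (liftState L P1.toState) :=
  ⟨ScopeBaseChange.spineEdge_map (φ3 L) spineEdge_P1_x4, localWin_P1_allFields L⟩

end AllFields

end CrossingFix

end Summit.ResolutionOfSingularities.ResolutionOfSingularities.Theorems.PIDim4

end
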